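import Mathlib.Analysis.Calculus.Deriv.MeanValue
import Mathlib.Analysis.SpecialFunctions.Log.Basic
import Summits.Ventures.CertifiedManyBodySolver.Downfold.RouterWord
import HarnessLib

/-!
# The box and the router word on a pressure INTERVAL, from the boxes at its two computed end points

Venture CertifiedManyBodySolver, cell `pub/hubbard-downfold` (stage S1 = downfolding front end =
ROUTER), seat hubbard-downfold-mod-2; namespaces `Summit.Ventures.CertifiedManyBodySolver.Downfold`
(`.Inflation`: one-coordinate calculus; `.Router`: rows and the routed word). HUMAN RULING D-0099
asks for output «along this range of temperatures and pressures»; S1 computes a parameter box at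
finitely many pressures of a material, and between two computed points a phase-map cell is today of
confidence class «extrapolated» (deputy-2 ACCEPTANCE §4). This file proves what the two END-POINT
boxes already certify about every pressure in between (parameter `u` = `P`, `V` or `log V` on
`[a, b]`; statements are parametrisation-free), per coordinate `f` (`router/INFLATION-RULES.md`
§P.12):
* §1 SIGN-DEFINITE coordinates (`t`, `W₁`, `t_pd`, `t_pp`, `Δ_pd`, `J`: monotone in the volume,
  §P.5d(iii)): `mem_Icc_min_max_of_monotoneOn_or_antitoneOn` — end-point boxes `f a ∈ [lo₁, hi₁]`,
  `f b ∈ [lo₂, hi₂]` ⇒ `f u ∈ [min lo₁ lo₂, max hi₁ hi₂]` on `[a, b]`: the HULL of the two point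
  boxes is the box of the whole pressure interval, NO interpolation pad (derivative forms
  `antitoneOn_Icc_of_deriv_nonpos`, `monotoneOn_Icc_of_deriv_nonneg`, `mem_Icc_min_max_of_deriv_sign`).
* §1 coordinates WITHOUT a sign (`U/t`, `t'/t`) with a sensitivity bound `|f'| ≤ S` along
  `u = log V`: `abs_sub_le_of_abs_deriv_le`; one-sided enclosures `mem_Icc_of_abs_deriv_le_left` /
  `_right` (= EXTRAPOLATION beyond the last computed point, pad `S |u - a|`); the INTERPOLATION
  enclosure `mem_Icc_interp_of_abs_deriv_le` (pad `S · min (u - a) (b - u)`), its uniform form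
  `mem_Icc_interp_half_of_abs_deriv_le` (hull padded by `S (b - a) / 2`) and the printed
  multiplicative form `exp_mem_Icc_interp_half` (`[min lo · e^{-S L/2}, max hi · e^{+S L/2}]`,
  `L = |log V₁ - log V₂|`); GRID RULE `half_spacing_pad_le`: spacing `L ≤ 2Δ` ⇒ interpolation pad
  `S L / 2 ≤ S Δ` = the at-point pad of §P.11 (`Δ = 0.03` ⇒ `L ≤ 0.06`, the §P.9(c) spacing).
* §2 the ROUTER on the interval box: `mem_ratCast_sup_of_mem_Icc` (a value between two enclosed
  values lies in the hull interval `I ⊔ J`; padded form `mem_ratCast_sup_inflate_of_mem_Icc`),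
  `Skel.mem_hull_of_coords`, `Router.Atom.inside_hull` / `Router.Row.fires_hull` (firing on both
  end-point skeletons ⇒ firing on their hull; converse direction of `RouterWord.route_hull`),
  `Router.route_table_of_fires` (any firing row of a consistent table IS the verdict),
  `Router.route_hull_of_fires`; assembled: `Router.Row.sat_on_Icc_of_monotone` — **the same row
  fires at both computed pressures and every present coordinate is monotone in between ⇒ that
  row's word holds at EVERY pressure of `[P₁, P₂]`** (the S1 half of D-0099's pressure continuum:
  the interval inherits the end points' confidence class instead of «extrapolated»); for
  coordinates without a sign the interval skeleton is the padded hull and `Row.fires_sound`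
  applies to it verbatim.

Everything is PROVED (Mathlib's mean value inequalities and `antitoneOn_of_hasDerivWithinAt_nonpos`;
the tree's `IntervalEnclosure`, `RouterWindows`, `RouterWord`). WHAT THIS IS NOT: a certified
statement about any material, a value of `S`, or a claim that a coordinate IS monotone in the
volume — monotonicity and the sensitivity bound are the modelling inputs of §P (measured secant
pairs, §P.5c), and the end-point boxes are SYSTEMATIC (screening-grade) claims; this file only
fixes what follows from them between and beyond the computed points.
-/

open Set

namespace Summit.Ventures.CertifiedManyBodySolver.Downfold

/-! ## §1 One coordinate along the pressure / log-volume axis -/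

namespace Inflation

/-- An antitone coordinate on `[a, b]` lies, at every intermediate point, between its end-point
values: `f u ∈ [f b, f a]`. [folklore] -/
theorem mem_Icc_of_antitoneOn {f : ℝ → ℝ} {a b u : ℝ} (hf : AntitoneOn f (Icc a b))
    (hu : u ∈ Icc a b) : f u ∈ Icc (f b) (f a) := by
  have hab : a ≤ b := hu.1.trans hu.2
  exact ⟨hf hu (right_mem_Icc.2 hab) hu.2, hf (left_mem_Icc.2 hab) hu hu.1⟩

/-- A monotone coordinate on `[a, b]` lies, at every intermediate point, between its end-point
values: `f u ∈ [f a, f b]`. [folklore] -/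
theorem mem_Icc_of_monotoneOn {f : ℝ → ℝ} {a b u : ℝ} (hf : MonotoneOn f (Icc a b))
    (hu : u ∈ Icc a b) : f u ∈ Icc (f a) (f b) := by
  have hab : a ≤ b := hu.1.trans hu.2
  exact ⟨hf (left_mem_Icc.2 hab) hu hu.1, hf hu (right_mem_Icc.2 hab) hu.2⟩

/-- **Sign-definite coordinate: the hull of the two end-point boxes is the box of the whole
interval, no pad.** If `f` is monotone or antitone on `[a, b]`, `f a ∈ [lo₁, hi₁]` and
`f b ∈ [lo₂, hi₂]`, then `f u ∈ [min lo₁ lo₂, max hi₁ hi₂]` for every `u ∈ [a, b]`. [folklore] -/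
theorem mem_Icc_min_max_of_monotoneOn_or_antitoneOn {f : ℝ → ℝ} {a b u lo₁ hi₁ lo₂ hi₂ : ℝ}
    (hf : MonotoneOn f (Icc a b) ∨ AntitoneOn f (Icc a b))
    (ha : f a ∈ Icc lo₁ hi₁) (hb : f b ∈ Icc lo₂ hi₂) (hu : u ∈ Icc a b) :
    f u ∈ Icc (min lo₁ lo₂) (max hi₁ hi₂) := by
  rcases hf with hf | hf
  · obtain ⟨h1, h2⟩ := mem_Icc_of_monotoneOn hf hu
    exact ⟨(min_le_left _ _).trans (ha.1.trans h1), (h2.trans hb.2).trans (le_max_right _ _)⟩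
  · obtain ⟨h1, h2⟩ := mem_Icc_of_antitoneOn hf hu
    exact ⟨(min_le_right _ _).trans (hb.1.trans h1), (h2.trans ha.2).trans (le_max_left _ _)⟩

/-- Derivative form of antitonicity on a closed interval: `f` continuous on `[a, b]` with
derivative `f' ≤ 0` on `(a, b)` is antitone on `[a, b]` (Mathlib's
`antitoneOn_of_hasDerivWithinAt_nonpos`, repackaged in the hypothesis style of
`Downfold.InflationSecant`). [folklore] -/
theorem antitoneOn_Icc_of_deriv_nonpos {f f' : ℝ → ℝ} {a b : ℝ}
    (hcont : ContinuousOn f (Icc a b)) (hder : ∀ x ∈ Ioo a b, HasDerivAt f (f' x) x)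
    (hsign : ∀ x ∈ Ioo a b, f' x ≤ 0) : AntitoneOn f (Icc a b) := by
  refine antitoneOn_of_hasDerivWithinAt_nonpos (f' := f') (convex_Icc a b) hcont ?_ ?_
  · intro x hx; rw [interior_Icc] at hx ⊢; exact (hder x hx).hasDerivWithinAt
  · intro x hx; rw [interior_Icc] at hx; exact hsign x hx

/-- Derivative form of monotonicity on a closed interval: `f' ≥ 0` on `(a, b)` ⇒ `f` monotone on
`[a, b]`. [folklore] -/
theorem monotoneOn_Icc_of_deriv_nonneg {f f' : ℝ → ℝ} {a b : ℝ}
    (hcont : ContinuousOn f (Icc a b)) (hder : ∀ x ∈ Ioo a b, HasDerivAt f (f' x) x)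
    (hsign : ∀ x ∈ Ioo a b, 0 ≤ f' x) : MonotoneOn f (Icc a b) := by
  refine monotoneOn_of_hasDerivWithinAt_nonneg (f' := f') (convex_Icc a b) hcont ?_ ?_
  · intro x hx; rw [interior_Icc] at hx ⊢; exact (hder x hx).hasDerivWithinAt
  · intro x hx; rw [interior_Icc] at hx; exact hsign x hx

/-- **Sign-definite coordinate, derivative form.** `f' ≤ 0` on `(a, b)` (or `f' ≥ 0` there) and
end-point enclosures `f a ∈ [lo₁, hi₁]`, `f b ∈ [lo₂, hi₂]` ⇒ `f u ∈ [min lo₁ lo₂, max hi₁ hi₂]`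
on `[a, b]`. [folklore] -/
theorem mem_Icc_min_max_of_deriv_sign {f f' : ℝ → ℝ} {a b u lo₁ hi₁ lo₂ hi₂ : ℝ}
    (hcont : ContinuousOn f (Icc a b)) (hder : ∀ x ∈ Ioo a b, HasDerivAt f (f' x) x)
    (hsign : (∀ x ∈ Ioo a b, f' x ≤ 0) ∨ (∀ x ∈ Ioo a b, 0 ≤ f' x))
    (ha : f a ∈ Icc lo₁ hi₁) (hb : f b ∈ Icc lo₂ hi₂) (hu : u ∈ Icc a b) :
    f u ∈ Icc (min lo₁ lo₂) (max hi₁ hi₂) := by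
  rcases hsign with hs | hs
  · exact mem_Icc_min_max_of_monotoneOn_or_antitoneOn
      (Or.inr (antitoneOn_Icc_of_deriv_nonpos hcont hder hs)) ha hb hu
  · exact mem_Icc_min_max_of_monotoneOn_or_antitoneOn
      (Or.inl (monotoneOn_Icc_of_deriv_nonneg hcont hder hs)) ha hb hu

/-- **Sensitivity bound ⇒ Lipschitz along the axis.** `f` continuous on `[a, b]`, derivative
`f'` on `(a, b)` with `|f'| ≤ S`; then `|f y - f x| ≤ S (y - x)` for `a ≤ x ≤ y ≤ b` (mean value
inequality). [folklore] -/
theorem abs_sub_le_of_abs_deriv_le {f f' : ℝ → ℝ} {a b S x y : ℝ}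
    (hcont : ContinuousOn f (Icc a b)) (hder : ∀ x ∈ Ioo a b, HasDerivAt f (f' x) x)
    (hS : ∀ x ∈ Ioo a b, |f' x| ≤ S) (hx : x ∈ Icc a b) (hy : y ∈ Icc a b) (hxy : x ≤ y) :
    |f y - f x| ≤ S * (y - x) := by
  have hdiff : DifferentiableOn ℝ f (interior (Icc a b)) := by
    rw [interior_Icc]; exact fun z hz => (hder z hz).differentiableAt.differentiableWithinAt
  have hle : ∀ z ∈ interior (Icc a b), deriv f z ≤ S := by
    rw [interior_Icc]; intro z hz; rw [(hder z hz).deriv]; exact (abs_le.1 (hS z hz)).2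
  have hge : ∀ z ∈ interior (Icc a b), -S ≤ deriv f z := by
    rw [interior_Icc]; intro z hz; rw [(hder z hz).deriv]; exact (abs_le.1 (hS z hz)).1
  have h1 := (convex_Icc a b).image_sub_le_mul_sub_of_deriv_le hcont hdiff hle x hx y hy hxy
  have h2 := (convex_Icc a b).mul_sub_le_image_sub_of_le_deriv hcont hdiff hge x hx y hy hxy
  rw [abs_le]
  constructor <;> linarith

/-- **One-sided enclosure from the box at the left end** (EXTRAPOLATION beyond a computed point,
or the left half of an interpolation): `|f'| ≤ S` on `(a, b)`, `f a ∈ [lo, hi]` ⇒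
`f u ∈ [lo - S (u - a), hi + S (u - a)]` for `u ∈ [a, b]`. [folklore] -/
theorem mem_Icc_of_abs_deriv_le_left {f f' : ℝ → ℝ} {a b S u lo hi : ℝ}
    (hcont : ContinuousOn f (Icc a b)) (hder : ∀ x ∈ Ioo a b, HasDerivAt f (f' x) x)
    (hS : ∀ x ∈ Ioo a b, |f' x| ≤ S) (ha : f a ∈ Icc lo hi) (hu : u ∈ Icc a b) :
    f u ∈ Icc (lo - S * (u - a)) (hi + S * (u - a)) := by
  have hab : a ≤ b := hu.1.trans hu.2
  have h := abs_sub_le_of_abs_deriv_le hcont hder hS (left_mem_Icc.2 hab) hu hu.1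
  rw [abs_le] at h
  constructor <;> linarith [ha.1, ha.2, h.1, h.2]

/-- **One-sided enclosure from the box at the right end**: `f b ∈ [lo, hi]` ⇒
`f u ∈ [lo - S (b - u), hi + S (b - u)]` for `u ∈ [a, b]`. [folklore] -/
theorem mem_Icc_of_abs_deriv_le_right {f f' : ℝ → ℝ} {a b S u lo hi : ℝ}
    (hcont : ContinuousOn f (Icc a b)) (hder : ∀ x ∈ Ioo a b, HasDerivAt f (f' x) x)
    (hS : ∀ x ∈ Ioo a b, |f' x| ≤ S) (hb : f b ∈ Icc lo hi) (hu : u ∈ Icc a b) :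
    f u ∈ Icc (lo - S * (b - u)) (hi + S * (b - u)) := by
  have hab : a ≤ b := hu.1.trans hu.2
  have h := abs_sub_le_of_abs_deriv_le hcont hder hS hu (right_mem_Icc.2 hab) hu.2
  rw [abs_le] at h
  constructor <;> linarith [hb.1, hb.2, h.1, h.2]

/-- **INTERPOLATION enclosure (coordinate without a sign).** `|f'| ≤ S` on `(a, b)`, end-point
boxes `f a ∈ [lo₁, hi₁]`, `f b ∈ [lo₂, hi₂]` ⇒ for `u ∈ [a, b]`,
`f u ∈ [min lo₁ lo₂ - S δ, max hi₁ hi₂ + S δ]` with `δ = min (u - a) (b - u)` = the distance to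
the NEARER computed point. [folklore] -/
theorem mem_Icc_interp_of_abs_deriv_le {f f' : ℝ → ℝ} {a b S u lo₁ hi₁ lo₂ hi₂ : ℝ}
    (hcont : ContinuousOn f (Icc a b)) (hder : ∀ x ∈ Ioo a b, HasDerivAt f (f' x) x)
    (hS : ∀ x ∈ Ioo a b, |f' x| ≤ S) (ha : f a ∈ Icc lo₁ hi₁) (hb : f b ∈ Icc lo₂ hi₂)
    (hu : u ∈ Icc a b) :
    f u ∈ Icc (min lo₁ lo₂ - S * min (u - a) (b - u)) (max hi₁ hi₂ + S * min (u - a) (b - u)) := by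
  obtain ⟨l1, r1⟩ := mem_Icc_of_abs_deriv_le_left hcont hder hS ha hu
  obtain ⟨l2, r2⟩ := mem_Icc_of_abs_deriv_le_right hcont hder hS hb hu
  rcases le_total (u - a) (b - u) with h | h
  · rw [min_eq_left h]
    exact ⟨by linarith [min_le_left lo₁ lo₂], by linarith [le_max_left hi₁ hi₂]⟩
  · rw [min_eq_right h]
    exact ⟨by linarith [min_le_right lo₁ lo₂], by linarith [le_max_right hi₁ hi₂]⟩

/-- **Uniform interpolation pad = half the spacing.** Under the same hypotheses with `0 ≤ S`:
`f u ∈ [min lo₁ lo₂ - S (b - a)/2, max hi₁ hi₂ + S (b - a)/2]` for every `u ∈ [a, b]` — the hull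
of the two end-point boxes padded by `S L / 2`, `L = b - a` the spacing of the two computed points
along the axis on which `S` is a sensitivity (`log V`). [folklore] -/
theorem mem_Icc_interp_half_of_abs_deriv_le {f f' : ℝ → ℝ} {a b S u lo₁ hi₁ lo₂ hi₂ : ℝ}
    (hcont : ContinuousOn f (Icc a b)) (hder : ∀ x ∈ Ioo a b, HasDerivAt f (f' x) x)
    (hS : ∀ x ∈ Ioo a b, |f' x| ≤ S) (hS0 : 0 ≤ S) (ha : f a ∈ Icc lo₁ hi₁)
    (hb : f b ∈ Icc lo₂ hi₂) (hu : u ∈ Icc a b) :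
    f u ∈ Icc (min lo₁ lo₂ - S * ((b - a) / 2)) (max hi₁ hi₂ + S * ((b - a) / 2)) := by
  obtain ⟨l, r⟩ := mem_Icc_interp_of_abs_deriv_le hcont hder hS ha hb hu
  have hmin : min (u - a) (b - u) ≤ (b - a) / 2 := by
    rcases le_total (u - a) (b - u) with h | h
    · rw [min_eq_left h]; linarith
    · rw [min_eq_right h]; linarith
  have := mul_le_mul_of_nonneg_left hmin hS0
  constructor <;> linarith

/-- **Multiplicative reading** of an enclosure of a log-coordinate: if `log x ∈ [log L - p, log H + p]`
with `x, L, H > 0` then `x ∈ [L e^{-p}, H e^{p}]`. [folklore] -/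
theorem mem_Icc_mul_exp_of_log_mem_Icc {x L H p : ℝ} (hx : 0 < x) (hL : 0 < L) (hH : 0 < H)
    (h : Real.log x ∈ Icc (Real.log L - p) (Real.log H + p)) :
    x ∈ Icc (L * Real.exp (-p)) (H * Real.exp p) := by
  obtain ⟨h1, h2⟩ := h
  constructor
  · have := Real.exp_le_exp.2 h1
    rw [Real.exp_sub, Real.exp_log hL, Real.exp_log hx] at this
    rwa [Real.exp_neg, ← div_eq_mul_inv]
  · have := Real.exp_le_exp.2 h2
    rwa [Real.exp_add, Real.exp_log hH, Real.exp_log hx] at this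

/-- **The printed interval box of a coordinate without a sign**: with `X = exp ∘ f` (so `f = log X`
along `u = log V`), `|f'| ≤ S` (`0 ≤ S`) on `(a, b)`, end-point boxes `X(a) ∈ [lo₁, hi₁]`,
`X(b) ∈ [lo₂, hi₂]` with positive lower ends: for every `u ∈ [a, b]`,
`X(u) ∈ [min lo₁ lo₂ · e^{-S (b-a)/2}, max hi₁ hi₂ · e^{+S (b-a)/2}]` (§P.12(b):
hull × `e^{± S L / 2}`). [folklore] -/
theorem exp_mem_Icc_interp_half {f f' : ℝ → ℝ} {a b S u lo₁ hi₁ lo₂ hi₂ : ℝ}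
    (hcont : ContinuousOn f (Icc a b)) (hder : ∀ x ∈ Ioo a b, HasDerivAt f (f' x) x)
    (hS : ∀ x ∈ Ioo a b, |f' x| ≤ S) (hS0 : 0 ≤ S) (hlo₁ : 0 < lo₁) (hlo₂ : 0 < lo₂)
    (ha : Real.exp (f a) ∈ Icc lo₁ hi₁) (hb : Real.exp (f b) ∈ Icc lo₂ hi₂) (hu : u ∈ Icc a b) :
    Real.exp (f u) ∈ Icc (min lo₁ lo₂ * Real.exp (-(S * ((b - a) / 2))))
      (max hi₁ hi₂ * Real.exp (S * ((b - a) / 2))) := by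
  have hhi₁ : 0 < hi₁ := hlo₁.trans_le (ha.1.trans ha.2)
  have hhi₂ : 0 < hi₂ := hlo₂.trans_le (hb.1.trans hb.2)
  have ha' : f a ∈ Icc (Real.log lo₁) (Real.log hi₁) :=
    ⟨(Real.log_le_iff_le_exp hlo₁).2 ha.1, (Real.le_log_iff_exp_le hhi₁).2 ha.2⟩
  have hb' : f b ∈ Icc (Real.log lo₂) (Real.log hi₂) :=
    ⟨(Real.log_le_iff_le_exp hlo₂).2 hb.1, (Real.le_log_iff_exp_le hhi₂).2 hb.2⟩
  obtain ⟨l, r⟩ := mem_Icc_interp_half_of_abs_deriv_le hcont hder hS hS0 ha' hb' hu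
  have hmin : min (Real.log lo₁) (Real.log lo₂) = Real.log (min lo₁ lo₂) := by
    rcases le_total lo₁ lo₂ with h | h
    · rw [min_eq_left h, min_eq_left ((Real.log_le_log_iff hlo₁ hlo₂).2 h)]
    · rw [min_eq_right h, min_eq_right ((Real.log_le_log_iff hlo₂ hlo₁).2 h)]
  have hmax : max (Real.log hi₁) (Real.log hi₂) = Real.log (max hi₁ hi₂) := by
    rcases le_total hi₁ hi₂ with h | h
    · rw [max_eq_right h, max_eq_right ((Real.log_le_log_iff hhi₁ hhi₂).2 h)]
    · rw [max_eq_left h, max_eq_left ((Real.log_le_log_iff hhi₂ hhi₁).2 h)]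
  rw [hmin] at l
  rw [hmax] at r
  exact mem_Icc_mul_exp_of_log_mem_Icc (Real.exp_pos _) (lt_min hlo₁ hlo₂) (lt_max_of_lt_left hhi₁)
    (p := S * ((b - a) / 2)) (by rw [Real.log_exp]; exact ⟨l, r⟩)

/-- **GRID RULE.** If two consecutive computed points are at most `2Δ` apart along the axis
(`L ≤ 2Δ`) then the uniform interpolation pad `S L / 2` is at most the at-point pad `S Δ`
(§P.11: `Δ = 0.03`, so a grid with `|log V_{i+1} - log V_i| ≤ 0.06` — the §P.9(c) spacing — makes
the between-points box no wider than a not-printed-structure point box). [folklore] -/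
theorem half_spacing_pad_le {S L Δ : ℝ} (hS : 0 ≤ S) (hL : L ≤ 2 * Δ) : S * (L / 2) ≤ S * Δ :=
  mul_le_mul_of_nonneg_left (by linarith) hS

end Inflation

/-! ## §2 The router on the interval box -/

section Hull

variable {K : Type*} [Field K] [LinearOrder K] [IsStrictOrderedRing K]

/-- **A value lying between two enclosed values lies in the hull interval.** `x ∈ I`, `y ∈ J`,
`z ∈ [min x y, max x y]` ⇒ `z ∈ I ⊔ J` (Mathlib's interval hull, end points `min` / `max`; cast
into the field `K`). [cite: Moore1966, Ch. 2] -/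
theorem mem_ratCast_sup_of_mem_Icc {I J : NonemptyInterval ℚ} {x y z : K}
    (hx : x ∈ I.ratCast K) (hy : y ∈ J.ratCast K) (hz : z ∈ Icc (min x y) (max x y)) :
    z ∈ (I ⊔ J).ratCast K := by
  rw [NonemptyInterval.mem_ratCast_iff] at hx hy ⊢
  obtain ⟨hz1, hz2⟩ := hz
  have h1 : (((I ⊔ J).fst : ℚ) : K) = min (I.fst : K) (J.fst : K) := by
    rw [NonemptyInterval.fst_sup]; exact Rat.cast_min _ _
  have h2 : (((I ⊔ J).snd : ℚ) : K) = max (I.snd : K) (J.snd : K) := by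
    rw [NonemptyInterval.snd_sup]; exact Rat.cast_max _ _
  rw [h1, h2]
  exact ⟨(min_le_min hx.1 hy.1).trans hz1, hz2.trans (max_le_max hx.2 hy.2)⟩

/-- **Padded hull** (coordinate without a sign): `x ∈ I`, `y ∈ J`,
`z ∈ [min x y - r, max x y + r]` (`r ≥ 0` rational) ⇒ `z ∈ (I ⊔ J).inflate r`.
[cite: Moore1966, Ch. 2] -/
theorem mem_ratCast_sup_inflate_of_mem_Icc {I J : NonemptyInterval ℚ} {r : ℚ≥0} {x y z : K}
    (hx : x ∈ I.ratCast K) (hy : y ∈ J.ratCast K)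
    (hz : z ∈ Icc (min x y - ((r : ℚ) : K)) (max x y + ((r : ℚ) : K))) :
    z ∈ ((I ⊔ J).inflate r).ratCast K := by
  rw [NonemptyInterval.mem_ratCast_iff] at hx hy ⊢
  obtain ⟨hz1, hz2⟩ := hz
  have h1 : (((I ⊔ J).fst : ℚ) : K) = min (I.fst : K) (J.fst : K) := by
    rw [NonemptyInterval.fst_sup]; exact Rat.cast_min _ _
  have h2 : (((I ⊔ J).snd : ℚ) : K) = max (I.snd : K) (J.snd : K) := by
    rw [NonemptyInterval.snd_sup]; exact Rat.cast_max _ _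
  simp only [NonemptyInterval.fst_inflate, NonemptyInterval.snd_inflate, Rat.cast_sub,
    Rat.cast_add, h1, h2]
  exact ⟨by linarith [min_le_min hx.1 hy.1], by linarith [max_le_max hx.2 hy.2]⟩

end Hull

namespace Skel

variable {ι : Type*} {K : Type*} [Field K] [LinearOrder K] [IsStrictOrderedRing K]

/-- The hull skeleton's entry at `i`: present iff present in both, and then the interval hull.
[folklore] -/
theorem hull_eq_some_iff {S₁ S₂ : Skel ι} {i : ι} {L : NonemptyInterval ℚ} :
    S₁.hull S₂ i = some L ↔ ∃ I J, S₁ i = some I ∧ S₂ i = some J ∧ I ⊔ J = L := by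
  unfold hull
  rcases h1 : S₁ i with _ | I <;> rcases h2 : S₂ i with _ | J <;> simp

/-- **Membership in the hull skeleton, coordinate by coordinate**: if on every coordinate present
in both skeletons the vector's entry lies in the hull interval, the vector is admitted by the hull
skeleton. [folklore] -/
theorem mem_hull_of_coords {S₁ S₂ : Skel ι} {p : ι → K}
    (h : ∀ i I J, S₁ i = some I → S₂ i = some J → p i ∈ (I ⊔ J).ratCast K) :
    (S₁.hull S₂).Mem p := by
  intro i L hL
  obtain ⟨I, J, hI, hJ, rfl⟩ := hull_eq_some_iff.1 hL
  exact h i I J hI hJ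

end Skel

namespace Router

variable {ι : Type*} {K : Type*} [Field K] [LinearOrder K] [IsStrictOrderedRing K]
variable {ω : Type*}

/-- **A window INSIDE both end-point skeletons is inside their hull** (the firing region of a
window is an interval, hence contains the hull of two sub-intervals). [folklore] -/
theorem Atom.inside_hull {a : Atom ι} {S₁ S₂ : Skel ι} (h₁ : a.inside S₁ = true)
    (h₂ : a.inside S₂ = true) : a.inside (S₁.hull S₂) = true := by
  obtain ⟨I, hI, hloI, hhiI⟩ := (Atom.inside_iff a S₁).1 h₁
  obtain ⟨J, hJ, hloJ, hhiJ⟩ := (Atom.inside_iff a S₂).1 h₂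
  refine (Atom.inside_iff a _).2 ⟨I ⊔ J, Skel.hull_eq_some_iff.2 ⟨I, J, hI, hJ, rfl⟩, ?_, ?_⟩
  · rw [Atom.loOk_iff] at hloI hloJ ⊢
    intro l hl
    rw [NonemptyInterval.fst_sup]
    exact le_inf (hloI l hl) (hloJ l hl)
  · rw [Atom.hiOk_iff] at hhiI hhiJ ⊢
    intro h hh
    rw [NonemptyInterval.snd_sup]
    exact sup_le (hhiI h hh) (hhiJ h hh)

/-- **A row FIRING on both end-point skeletons fires on their hull** — the converse direction of
`RouterWord.route_hull` (there: hull ⇒ each). [folklore] -/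
theorem Row.fires_hull {r : Row ι ω} {S₁ S₂ : Skel ι} (h₁ : r.fires S₁ = true)
    (h₂ : r.fires S₂ = true) : r.fires (S₁.hull S₂) = true := by
  unfold Row.fires at h₁ h₂ ⊢
  rw [List.all_eq_true] at h₁ h₂ ⊢
  exact fun a ha => Atom.inside_hull (h₁ a ha) (h₂ a ha)

/-- **Any firing row of a consistent table IS the verdict** (row order immaterial): if `r ∈ T`
fires on `S` then `route T S = table r.out`. [folklore] -/
theorem route_table_of_fires {T : List (Row ι ω)} (hT : Consistent T) {S : Skel ι} {r : Row ι ω}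
    (hr : r ∈ T) (hf : r.fires S = true) : route T S = .table r.out := by
  rcases hfind : T.find? (fun r => r.fires S) with _ | r'
  · rw [List.find?_eq_none] at hfind
    exact absurd hf (by simpa using hfind r hr)
  · have hr'f : r'.fires S = true := by simpa using List.find?_some hfind
    have hr'T : r' ∈ T := List.mem_of_find?_eq_some hfind
    have hout : r'.out = r.out := hT r' hr'T r hr (S.basePoint ℝ)
      (Row.fires_sound hr'f S.basePoint_mem) (Row.fires_sound hf S.basePoint_mem)
    simp [route, hfind, hout]

/-- **Same row at both computed end points ⇒ the same table word on the hull skeleton.**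
[folklore] -/
theorem route_hull_of_fires {T : List (Row ι ω)} (hT : Consistent T) {S₁ S₂ : Skel ι}
    {r : Row ι ω} (hr : r ∈ T) (h₁ : r.fires S₁ = true) (h₂ : r.fires S₂ = true) :
    route T (S₁.hull S₂) = .table r.out :=
  route_table_of_fires hT hr (Row.fires_hull h₁ h₂)

/-- **A word along a path admitted by the hull skeleton.** If every parameter vector `p u`
(`u ∈ P`, e.g. the pressures of an interval) is admitted by the hull of the two end-point
skeletons and the row fires on both end points, the row's conjunction of windows — its word —
holds at every `u ∈ P`. [folklore] -/
theorem Row.sat_along_of_fires {r : Row ι ω} {S₁ S₂ : Skel ι} {α : Type*} {P : Set α}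
    {p : α → ι → K} (hpath : ∀ u ∈ P, (S₁.hull S₂).Mem (p u)) (h₁ : r.fires S₁ = true)
    (h₂ : r.fires S₂ = true) : ∀ u ∈ P, r.Sat (p u) :=
  fun u hu => Row.fires_sound (Row.fires_hull h₁ h₂) (hpath u hu)

/-- **THE PRESSURE-INTERVAL WORD (sign-definite coordinates).** A parameter path
`p : ℝ → ι → ℝ` on `[a, b]` (`u` = pressure, volume or log-volume between two computed points),
the skeleton `S₁` admitting `p a` and `S₂` admitting `p b` (the two point boxes), and every
coordinate present in BOTH skeletons monotone or antitone along the path: a row that fires on `S₁`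
and on `S₂` holds at EVERY `u ∈ [a, b]` — the router word of the two computed pressures is the word
of the whole pressure interval, with the confidence class of the end points. [folklore] -/
theorem Row.sat_on_Icc_of_monotone {r : Row ι ω} {S₁ S₂ : Skel ι} {p : ℝ → ι → ℝ} {a b : ℝ}
    (hmono : ∀ i I J, S₁ i = some I → S₂ i = some J →
      MonotoneOn (fun u => p u i) (Icc a b) ∨ AntitoneOn (fun u => p u i) (Icc a b))
    (ha : S₁.Mem (p a)) (hb : S₂.Mem (p b)) (h₁ : r.fires S₁ = true) (h₂ : r.fires S₂ = true) :
    ∀ u ∈ Icc a b, r.Sat (p u) := by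
  refine Row.sat_along_of_fires (P := Icc a b) (fun u hu => ?_) h₁ h₂
  refine Skel.mem_hull_of_coords fun i I J hI hJ => ?_
  have hx : p a i ∈ I.ratCast ℝ := ha i I hI
  have hy : p b i ∈ J.ratCast ℝ := hb i J hJ
  refine mem_ratCast_sup_of_mem_Icc hx hy ?_
  rcases hmono i I J hI hJ with hm | hm
  · obtain ⟨l, r⟩ := Inflation.mem_Icc_of_monotoneOn hm hu
    exact ⟨(min_le_left _ _).trans l, r.trans (le_max_right _ _)⟩
  · obtain ⟨l, r⟩ := Inflation.mem_Icc_of_antitoneOn hm hu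
    exact ⟨(min_le_right _ _).trans l, r.trans (le_max_left _ _)⟩

end Router

end Summit.Ventures.CertifiedManyBodySolver.Downfold
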